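import Mathlib
import Summits.CriticalPhenomena.PercolationContinuityZ3.Theorems.PercNearOneGluingNoHeavyLowerTailIntervalCertificates

/-!
# The trace lemma: differences of one family plus its meets with a trace-separated second family

Helper file for crux `stmt-CriticalPhenomena-4575` (`NoHeavyLowerTail`, route `PercNearOneGluingNoHeavy`),
new-inequality factory seat `prim-ineq-gen-3` (gen 7).  Everything here is PROVED.

**Trace lemma.**  Let `A` and `D` be finite families of finite sets inside a ground set `S`, cross-intersecting
(`X ∩ Z ≠ ∅` for `X ∈ A`, `Z ∈ D`), and suppose some `M ∈ A` *separates `D` by traces*: `Z ∩ M = Z' ∩ M`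
implies `Z = Z'` for `Z, Z' ∈ D`.  Then every family `K` containing the differences `A \\ A` and the meets
`A ⊼ D` has `#A + #D ≤ #K` (`card_add_card_le_card_of_traces`).  For `D = ∅` this is Marica–Schönheim; it is
a sibling of `MS2′` (`OrderedDifferences.card_add_card_le_card_diffs_union`, which needs `D \\ D` as well but
no trace hypothesis).

Proof: an interval certificate (`IntervalCertificate.card_le_card_of_certificate`, gen 6) — members of `A`
first, larger sets first, with the Möbius functionals of `X ∈ A` against the complements `S \ X'` (pairing
`[X ⊆ X']`) and against the members `Z ∈ D` themselves (pairing `[X ∩ Z = ∅] = 0`); then the members of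
`D`, larger traces first, each separated by its own trace `Z ∩ M ∈ A ⊼ D`, which lies in no later member.

**Three colours** (`card_le_card_ksym_of_traces`): for a 3-coloured family `A, B, C` in which `A` is
cross-intersecting with `B` and `C` and some `M ∈ A` separates `B ∪ C` by traces, the symmetric three-family
inequality `MS3-sym` of the memo holds: `#A + #B + #C ≤ #K_sym(A,B,C)` (`B`, `C` disjoint as families).  This
is the generic case of conjecture `MS3-sym` / `CERT-T` (memo MS3-STATE.md §3, COMB.md §3c (xx)): the
hypothesis holds in ≈ 95 % of the instances on six points; the remaining instances are exactly where the
conjectured per-member certificates must use other private elements (collapses, second traces) — open.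
(prim-ineq-gen-3 gen 7, 2026-08-20; memo `run/shared/lean/prim/prim-ineq-gen-3/MS3-STATE.md`.)
-/

namespace Summit.CriticalPhenomena.PercolationContinuityZ3.Theorems

namespace TraceCertificate

open Finset IntervalCertificate
open scoped FinsetFamily

variable {α : Type*} [DecidableEq α]

/-- **Trace lemma.**  `A, D` families of subsets of `S`, `A` cross-intersecting with `D`, and some `M ∈ A`
separating the members of `D` by their traces on `M`.  Then any `K ⊇ (A \\ A) ∪ (A ⊼ D)` has `#A + #D ≤ #K`. -/
theorem card_add_card_le_card_of_traces (S : Finset α) (A D K : Finset (Finset α)) {M : Finset α}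
    (hM : M ∈ A) (hAS : ∀ X ∈ A, X ⊆ S) (hAD : ∀ X ∈ A, ∀ Z ∈ D, (X ∩ Z).Nonempty)
    (htr : ∀ Z ∈ D, ∀ Z' ∈ D, Z ∩ M = Z' ∩ M → Z = Z')
    (hKdiff : A \\ A ⊆ K) (hKmeet : A ⊼ D ⊆ K) : #A + #D ≤ #K := by
  classical
  -- index type: members of `A` (coplain literals) and members of `D` (plain literals)
  let ι := ↥A ⊕ ↥D
  -- rank: `A` first, larger sets first; then `D`, larger traces on `M` first
  let r : ι → ℕ := fun i => match i with
    | Sum.inl X => #S - #(X : Finset α)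
    | Sum.inr Z => #S + 1 + (#S - #((Z : Finset α) ∩ M))
  let L : ι → Finset α := fun i => match i with
    | Sum.inl _ => ∅
    | Sum.inr Z => (Z : Finset α) ∩ M
  let U : ι → Finset α := fun i => match i with
    | Sum.inl X => (X : Finset α)
    | Sum.inr Z => (Z : Finset α) ∩ M
  let V : ι → Finset α := fun i => match i with
    | Sum.inl X => S \ (X : Finset α)
    | Sum.inr Z => (Z : Finset α)
  have h0K : (∅ : Finset α) ∈ K := by
    apply hKdiff
    rw [← Finset.sdiff_self M]
    exact sdiff_mem_diffs hM hM
  have hmeetK : ∀ X ∈ A, ∀ Z ∈ D, X ∩ Z ∈ K := fun X hX Z hZ =>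
    hKmeet (mem_infs.mpr ⟨X, hX, Z, hZ, rfl⟩)
  have hcard : Fintype.card ι = #A + #D := by
    simp only [ι, Fintype.card_sum, Fintype.card_coe]
  rw [← hcard]
  refine card_le_card_of_certificate K r L U V ?_ ?_ ?_
  · -- `L i = U i ∩ V i`
    rintro (X | Z)
    · show (∅ : Finset α) = (X : Finset α) ∩ (S \ (X : Finset α))
      rw [inter_sdiff_self]
    · show (Z : Finset α) ∩ M = ((Z : Finset α) ∩ M) ∩ (Z : Finset α)
      exact (inter_eq_left.mpr inter_subset_left).symm
  · -- `L i ∈ K`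
    rintro (X | Z)
    · exact h0K
    · show (Z : Finset α) ∩ M ∈ K
      rw [inter_comm]
      exact hmeetK M hM Z Z.2
  · -- separation along the rank
    rintro (X | Z) (X' | Z') hij hr
    · -- two members of `A`: `X ∩ (S \ X') = X \ X' ∈ A \\ A`, nonempty since `X ⊄ X'`
      right
      have hXS : (X : Finset α) ⊆ S := hAS X X.2
      have hX'S : (X' : Finset α) ⊆ S := hAS X' X'.2
      have hle : #(X' : Finset α) ≤ #(X : Finset α) := by
        have h1 : #(X : Finset α) ≤ #S := card_le_card hXS
        have h2 : #(X' : Finset α) ≤ #S := card_le_card hX'S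
        change #S - #(X : Finset α) ≤ #S - #(X' : Finset α) at hr
        omega
      have heq : (X : Finset α) ∩ (S \ (X' : Finset α)) = (X : Finset α) \ (X' : Finset α) := by
        ext x
        simp only [mem_inter, mem_sdiff]
        constructor
        · rintro ⟨hx, -, hx'⟩
          exact ⟨hx, hx'⟩
        · rintro ⟨hx, hx'⟩
          exact ⟨hx, hXS hx, hx'⟩
      change (X : Finset α) ∩ (S \ (X' : Finset α)) ∈ K ∧ (X : Finset α) ∩ (S \ (X' : Finset α)) ≠ ∅
      rw [heq]
      refine ⟨hKdiff (sdiff_mem_diffs X.2 X'.2), ?_⟩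
      intro hempty
      have hsub : (X : Finset α) ⊆ (X' : Finset α) := by
        intro x hx
        by_contra hx'
        have : x ∈ (X : Finset α) \ (X' : Finset α) := mem_sdiff.mpr ⟨hx, hx'⟩
        rw [hempty] at this
        simp at this
      exact hij (congrArg Sum.inl (Subtype.ext (eq_of_subset_of_card_le hsub hle)))
    · -- `X ∈ A` before `Z' ∈ D`: `X ∩ Z'` is a nonempty meet
      right
      change (X : Finset α) ∩ (Z' : Finset α) ∈ K ∧ (X : Finset α) ∩ (Z' : Finset α) ≠ ∅
      exact ⟨hmeetK X X.2 Z' Z'.2, (hAD X X.2 Z' Z'.2).ne_empty⟩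
    · -- `Z ∈ D` is never ranked before `X' ∈ A`
      exfalso
      have h1 : #(X' : Finset α) ≤ #S := card_le_card (hAS X' X'.2)
      change #S + 1 + (#S - #((Z : Finset α) ∩ M)) ≤ #S - #(X' : Finset α) at hr
      omega
    · -- two members of `D`: the trace `Z ∩ M` lies in no later member
      left
      change ¬ (Z : Finset α) ∩ M ⊆ (Z' : Finset α)
      intro hsub
      have hMS : M ⊆ S := hAS M hM
      have hle : #((Z' : Finset α) ∩ M) ≤ #((Z : Finset α) ∩ M) := by
        have h1 : #((Z : Finset α) ∩ M) ≤ #S := card_le_card (inter_subset_right.trans hMS)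
        have h2 : #((Z' : Finset α) ∩ M) ≤ #S := card_le_card (inter_subset_right.trans hMS)
        change #S + 1 + (#S - #((Z : Finset α) ∩ M)) ≤ #S + 1 + (#S - #((Z' : Finset α) ∩ M)) at hr
        omega
      have hsub' : (Z : Finset α) ∩ M ⊆ (Z' : Finset α) ∩ M := subset_inter hsub inter_subset_right
      have heq : (Z : Finset α) ∩ M = (Z' : Finset α) ∩ M := eq_of_subset_of_card_le hsub' hle
      exact hij (congrArg Sum.inr (Subtype.ext (htr Z Z.2 Z' Z'.2 heq)))

/-- **Three colours, generic case of `MS3-sym`.**  If `A` is cross-intersecting with `B` and with `C`, `B` and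
`C` are disjoint families, and some `M ∈ A` separates the members of `B ∪ C` by their traces on `M`, then
`#A + #B + #C ≤ #K_sym(A,B,C)`, `K_sym` written exactly as in
`OrientedAntipodalHall.card_le_card_goods_above_cyclic_of_sym` (within-family differences, cross meets,
collapse differences). -/
theorem card_le_card_ksym_of_traces (S : Finset α) (A B C : Finset (Finset α)) {M : Finset α}
    (hM : M ∈ A) (hAS : ∀ X ∈ A, X ⊆ S) (hAB : ∀ X ∈ A, ∀ Y ∈ B, (X ∩ Y).Nonempty)
    (hAC : ∀ X ∈ A, ∀ Z ∈ C, (X ∩ Z).Nonempty) (hBC : Disjoint B C)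
    (htr : ∀ Z ∈ B ∪ C, ∀ Z' ∈ B ∪ C, Z ∩ M = Z' ∩ M → Z = Z') :
    #A + #B + #C ≤
      #((A \\ A ∪ B \\ B ∪ C \\ C) ∪ (A ⊼ B ∪ B ⊼ C ∪ C ⊼ A) ∪
        ((((A ×ˢ (B ×ˢ C)).filter fun p => p.1 ∩ p.2.1 = p.1 ∩ p.2.2).image fun p => p.1 \ p.2.1) ∪
         (((B ×ˢ (C ×ˢ A)).filter fun p => p.1 ∩ p.2.1 = p.1 ∩ p.2.2).image fun p => p.1 \ p.2.1) ∪
         (((C ×ˢ (A ×ˢ B)).filter fun p => p.1 ∩ p.2.1 = p.1 ∩ p.2.2).image fun p => p.1 \ p.2.1))) := by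
  have hAD : ∀ X ∈ A, ∀ Z ∈ B ∪ C, (X ∩ Z).Nonempty := by
    intro X hX Z hZ
    rcases mem_union.mp hZ with hZ | hZ
    · exact hAB X hX Z hZ
    · exact hAC X hX Z hZ
  rw [add_assoc, ← card_union_of_disjoint hBC]
  refine card_add_card_le_card_of_traces S A (B ∪ C) _ hM hAS hAD htr ?_ ?_
  · intro T hT
    simp only [mem_union]
    exact Or.inl (Or.inl (Or.inl (Or.inl hT)))
  · intro T hT
    obtain ⟨X, hX, Z, hZ, rfl⟩ := mem_infs.mp hT
    simp only [mem_union]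
    rcases mem_union.mp hZ with hZ | hZ
    · exact Or.inl (Or.inr (Or.inl (Or.inl (mem_infs.mpr ⟨X, hX, Z, hZ, rfl⟩))))
    · refine Or.inl (Or.inr (Or.inr (mem_infs.mpr ⟨Z, hZ, X, hX, ?_⟩)))
      exact inf_comm Z X

/-- **Trace peeling** (the general form of the trace lemma).  `A` cross-intersecting with `D` inside `S`; a rank
`ρ` and a *separator* `σ : D → A` such that the trace `Z ∩ σ Z` of a member of `D` lies in no member of `D` of
equal or later rank.  Then any `K ⊇ (A \\ A) ∪ (A ⊼ D)` has `#A + #D ≤ #K`.  (`card_add_card_le_card_of_traces`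
is the case `σ ≡ M`, `ρ Z = #S - #(Z ∩ M)`.) -/
theorem card_add_card_le_card_of_tracePeeling (S : Finset α) (A D K : Finset (Finset α))
    (hAS : ∀ X ∈ A, X ⊆ S) (hAD : ∀ X ∈ A, ∀ Z ∈ D, (X ∩ Z).Nonempty)
    (ρ : Finset α → ℕ) (σ : Finset α → Finset α) (hσ : ∀ Z ∈ D, σ Z ∈ A)
    (hρ : ∀ Z ∈ D, ∀ Z' ∈ D, Z ≠ Z' → ρ Z ≤ ρ Z' → ¬ Z ∩ σ Z ⊆ Z')
    (hKdiff : A \\ A ⊆ K) (hKmeet : A ⊼ D ⊆ K) : #A + #D ≤ #K := by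
  classical
  let ι := ↥A ⊕ ↥D
  let r : ι → ℕ := fun i => match i with
    | Sum.inl X => #S - #(X : Finset α)
    | Sum.inr Z => #S + 1 + ρ (Z : Finset α)
  let L : ι → Finset α := fun i => match i with
    | Sum.inl _ => ∅
    | Sum.inr Z => (Z : Finset α) ∩ σ (Z : Finset α)
  let U : ι → Finset α := fun i => match i with
    | Sum.inl X => (X : Finset α)
    | Sum.inr Z => (Z : Finset α) ∩ σ (Z : Finset α)
  let V : ι → Finset α := fun i => match i with
    | Sum.inl X => S \ (X : Finset α)
    | Sum.inr Z => (Z : Finset α)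
  have hmeetK : ∀ X ∈ A, ∀ Z ∈ D, X ∩ Z ∈ K := fun X hX Z hZ =>
    hKmeet (mem_infs.mpr ⟨X, hX, Z, hZ, rfl⟩)
  have hcard : Fintype.card ι = #A + #D := by
    simp only [ι, Fintype.card_sum, Fintype.card_coe]
  rw [← hcard]
  refine card_le_card_of_certificate K r L U V ?_ ?_ ?_
  · rintro (X | Z)
    · show (∅ : Finset α) = (X : Finset α) ∩ (S \ (X : Finset α))
      rw [inter_sdiff_self]
    · show (Z : Finset α) ∩ σ (Z : Finset α) = ((Z : Finset α) ∩ σ (Z : Finset α)) ∩ (Z : Finset α)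
      exact (inter_eq_left.mpr inter_subset_left).symm
  · rintro (X | Z)
    · show (∅ : Finset α) ∈ K
      rw [← Finset.sdiff_self (X : Finset α)]
      exact hKdiff (sdiff_mem_diffs X.2 X.2)
    · show (Z : Finset α) ∩ σ (Z : Finset α) ∈ K
      rw [inter_comm]
      exact hmeetK _ (hσ Z Z.2) Z Z.2
  · rintro (X | Z) (X' | Z') hij hr
    · right
      have hXS : (X : Finset α) ⊆ S := hAS X X.2
      have hX'S : (X' : Finset α) ⊆ S := hAS X' X'.2
      have hle : #(X' : Finset α) ≤ #(X : Finset α) := by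
        have h1 : #(X : Finset α) ≤ #S := card_le_card hXS
        have h2 : #(X' : Finset α) ≤ #S := card_le_card hX'S
        change #S - #(X : Finset α) ≤ #S - #(X' : Finset α) at hr
        omega
      have heq : (X : Finset α) ∩ (S \ (X' : Finset α)) = (X : Finset α) \ (X' : Finset α) := by
        ext x
        simp only [mem_inter, mem_sdiff]
        constructor
        · rintro ⟨hx, -, hx'⟩
          exact ⟨hx, hx'⟩
        · rintro ⟨hx, hx'⟩
          exact ⟨hx, hXS hx, hx'⟩
      change (X : Finset α) ∩ (S \ (X' : Finset α)) ∈ K ∧ (X : Finset α) ∩ (S \ (X' : Finset α)) ≠ ∅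
      rw [heq]
      refine ⟨hKdiff (sdiff_mem_diffs X.2 X'.2), ?_⟩
      intro hempty
      have hsub : (X : Finset α) ⊆ (X' : Finset α) := by
        intro x hx
        by_contra hx'
        have : x ∈ (X : Finset α) \ (X' : Finset α) := mem_sdiff.mpr ⟨hx, hx'⟩
        rw [hempty] at this
        simp at this
      exact hij (congrArg Sum.inl (Subtype.ext (eq_of_subset_of_card_le hsub hle)))
    · right
      change (X : Finset α) ∩ (Z' : Finset α) ∈ K ∧ (X : Finset α) ∩ (Z' : Finset α) ≠ ∅
      exact ⟨hmeetK X X.2 Z' Z'.2, (hAD X X.2 Z' Z'.2).ne_empty⟩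
    · exfalso
      have h1 : #(X' : Finset α) ≤ #S := card_le_card (hAS X' X'.2)
      change #S + 1 + ρ (Z : Finset α) ≤ #S - #(X' : Finset α) at hr
      omega
    · left
      change ¬ (Z : Finset α) ∩ σ (Z : Finset α) ⊆ (Z' : Finset α)
      have hne : (Z : Finset α) ≠ (Z' : Finset α) := fun h => hij (congrArg Sum.inr (Subtype.ext h))
      have hle : ρ (Z : Finset α) ≤ ρ (Z' : Finset α) := by
        change #S + 1 + ρ (Z : Finset α) ≤ #S + 1 + ρ (Z' : Finset α) at hr
        omega
      exact hρ Z Z.2 Z' Z'.2 hne hle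

end TraceCertificate

end Summit.CriticalPhenomena.PercolationContinuityZ3.Theorems
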